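import Literature.Topology.FourManifolds.Gluing
import Literature.Topology.FourManifolds.BallGluingCharts
import Literature.Topology.FourManifolds.CollarExtension
import HarnessLib

/-!
# Witnesses of a gluing along the boundary: point-set structure, separation, flat charts

Infrastructure for the proof of the tree's named fact
`Literature.Topology.FourManifolds.nonempty_diffeomorph_of_isBoundaryGluing` (`Gluing.lean`;
Hirsch, *Differential Topology* (1976), Ch. 8 §2, Thm. 2.1 = Ch. 8 §1, Thm. 1.9;
Bröcker–Jänich, *Introduction to Differential Topology* (1982), (13.9) with (13.7)): two smooth
manifolds which are both the gluing `M ∪_φ N` of the same compact pieces along the same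
identification of the boundaries are diffeomorphic.

A *gluing datum* `G : BoundaryGluingData bM bN φ P` is a choice of witnesses of
`Literature.Topology.FourManifolds.IsBoundaryGluing bM bN φ (𝓡 (n + 1)) P`: smooth embeddings
`jA : M → P`, `jB : N → P` of the two `(n+1)`-manifolds with boundary into the `(n+1)`-manifold
without boundary `P`, covering `P` and meeting exactly along `∂M ≡_φ ∂N`.  This file records
the elementary structure of such a datum (everything is proved):

* the interiors `jA (Int M)`, `jB (Int N)` are open and are the complements of `range jB`,
  `range jA` (equidimensional immersions are open on interior points; no separation hypothesis
  on `P` is used), so the two pieces are *closed* and `P = jA (Int M) ⊔ seam ⊔ jB (Int N)` with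
  `seam = jA (∂M) = jB (∂N)`;
* **`P` is Hausdorff** as soon as `M` and `N` are (`BoundaryGluingData.t2Space`): a closed
  chart ball about `p` is closed in `P`, because its traces on the two closed pieces are images
  of compact sets under closed embeddings — this is why the fact in `Gluing.lean` needs no
  `T2Space P` hypothesis;
* `P` is compact (resp. σ-compact) when the pieces are compact;
* **flat charts** (`BoundaryGluingData.FlatChart`): at a seam point `jA (incl z)` there is a
  chart of the maximal `C^∞` atlas of `P` in which `jA` *is* a boundary chart of `M`
  (Mathlib's immersion data `Manifold.IsImmersionAt.domChart/codChart/equiv`, the linear part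
  inverted: `Manifold.IsImmersionAt.halfSpaceLinearPart/halfSpaceChart`, which generalise —
  and on discs coincide definitionally with, `halfSpaceChart_eq_normalChart` — the tree's disc
  versions `linearPart/normalChart` of `BallGluingCharts`; refactor: the disc versions are
  superseded by these),
  so that `range jA` is read as the closed upper half space `{0 ≤ u 0}` and the seam as the
  hyperplane `{u 0 = 0}` (invariance of the boundary for charts of the maximal atlas,
  `Literature.Topology.FourManifolds.isInteriorPoint_iff_of_mem_maximalAtlas`);
* smoothness *into* a manifold with boundary is tested after composition with a smooth
  embedding (`ContMDiffWithinAt.iff_comp_isImmersionAt`, the `Within` (lifting) form of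
  Mathlib's `ContMDiffAt.iff_comp_isImmersionAt`), whence the left inverse `jA⁻¹` is `C^∞` on `range jA`
  in the within sense (`contMDiffOn_invA`);
* the **comparison map** `G.compare G' : P → P'` between two gluings of the same pieces
  (`jA a ↦ jA' a`, `jB b ↦ jB' b`), a homeomorphism which is smooth off the seam, both ways
  (descent of smoothness along an open immersion,
  `Literature.Topology.FourManifolds.contMDiffAt_of_comp_isImmersionAt_of_nhds`) — the map `h`
  of Hirsch's smoothing theorem 8.1.9, which is in general *not* smooth across the seam.

## References

* M. W. Hirsch, *Differential Topology*, GTM 33, Springer (1976), Ch. 8 §1 Thm. 1.9, §2 Thm. 2.1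
  (held copy, PDF pp. 168–171). [HirschDT1976]
* Th. Bröcker, K. Jänich, *Introduction to Differential Topology*, CUP (1982), §13, (13.7)–(13.11)
  (held copy, PDF pp. 83–87). [BrockerJanich1982]
-/

open scoped Manifold ContDiff Topology
open Set Function Metric Filter Topology

noncomputable section

namespace Literature.Topology.FourManifolds

universe u w

/-- Local notation: `𝔼 n` is the model Euclidean space `EuclideanSpace ℝ (Fin n)`. -/
local notation "𝔼 " n:arg => EuclideanSpace ℝ (Fin n)
/-- Local notation: `ℍ n` is the closed half space `EuclideanHalfSpace n`. -/
local notation "ℍ " n:arg => EuclideanHalfSpace n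

/-! ### Gluing data -/

section Defs

variable {n : ℕ} {M N : Type u} [TopologicalSpace M] [ChartedSpace (ℍ (n + 1)) M]
  [TopologicalSpace N] [ChartedSpace (ℍ (n + 1)) N]

/-- **Witnesses of a gluing along the boundary.** For boundary data `bM`, `bN` of the
`(n+1)`-manifolds with boundary `M`, `N`, a bijection `φ : ∂M ≃ ∂N` and an `(n+1)`-manifold
without boundary `P`: smooth embeddings `jA : M → P`, `jB : N → P` whose ranges cover `P` and
such that `jA a = jB b` exactly when `a = incl z`, `b = incl (φ z)` — a choice of the witnesses
in `Literature.Topology.FourManifolds.IsBoundaryGluing bM bN φ (𝓡 (n + 1)) P` (`Gluing.lean`).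
**Not** to be confused with the tree's `BoundaryGlueData bM bN` (`BoundaryGluingConstruction.lean`),
which is the construction *input* (collars of the pieces and `φ`); the present structure is the
*output/witness* side.  Models (non-vacuity): `IsBoundaryGluing.nonempty_boundaryGluingData`
below turns any witness of the named predicate (e.g. `BoundaryGlueData.isBoundaryGluing` of the
construction, or the hypothesis of the named fact `nonempty_diffeomorph_of_isBoundaryGluing`
via `φ.toEquiv`) into such data, and `isBoundaryGluing_interiorSum` covers empty boundary.
Hirsch (1976), Ch. 8 §2 ("`W = P ∪_f Q` … containing natural copies of `P` and `Q`");
Bröcker–Jänich (1982), (13.8), (13.11). [cite: HirschDT1976, Ch. 8 §2, Thm. 2.1] -/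
structure BoundaryGluingData (bM : BoundaryData (𝓡∂ (n + 1)) M (𝓡 n))
    (bN : BoundaryData (𝓡∂ (n + 1)) N (𝓡 n)) (φ : bM.carrier ≃ bN.carrier) (P : Type w)
    [TopologicalSpace P] [ChartedSpace (𝔼 (n + 1)) P] where
  /-- The embedding of the first piece. -/
  jA : M → P
  /-- The embedding of the second piece. -/
  jB : N → P
  /-- `jA` is a smooth embedding. -/
  isSmoothEmbedding_jA : Manifold.IsSmoothEmbedding (𝓡∂ (n + 1)) (𝓡 (n + 1)) ∞ jA
  /-- `jB` is a smooth embedding. -/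
  isSmoothEmbedding_jB : Manifold.IsSmoothEmbedding (𝓡∂ (n + 1)) (𝓡 (n + 1)) ∞ jB
  /-- The two pieces cover `P`. -/
  range_union : range jA ∪ range jB = univ
  /-- The two pieces meet exactly along `∂M ≡_φ ∂N`. -/
  jA_eq_jB_iff : ∀ a b, jA a = jB b ↔ ∃ z, a = bM.incl z ∧ b = bN.incl (φ z)

variable {bM : BoundaryData (𝓡∂ (n + 1)) M (𝓡 n)} {bN : BoundaryData (𝓡∂ (n + 1)) N (𝓡 n)}
  {P : Type w} [TopologicalSpace P] [ChartedSpace (𝔼 (n + 1)) P]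

/-- A gluing along the boundary (along a bijection) admits gluing data. [folklore] -/
theorem IsBoundaryGluing.nonempty_boundaryGluingData {φ : bM.carrier ≃ bN.carrier}
    (h : IsBoundaryGluing bM bN φ (𝓡 (n + 1)) P) : Nonempty (BoundaryGluingData bM bN φ P) := by
  obtain ⟨jA, jB, hA, hB, hU, hR⟩ := h
  exact ⟨⟨jA, jB, hA, hB, hU, hR⟩⟩

/-- Gluing data witness a gluing along the boundary. [folklore] -/
theorem BoundaryGluingData.isBoundaryGluing {φ : bM.carrier ≃ bN.carrier}
    (G : BoundaryGluingData bM bN φ P) : IsBoundaryGluing bM bN φ (𝓡 (n + 1)) P :=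
  ⟨G.jA, G.jB, G.isSmoothEmbedding_jA, G.isSmoothEmbedding_jB, G.range_union, G.jA_eq_jB_iff⟩

namespace BoundaryGluingData

variable {φ : bM.carrier ≃ bN.carrier} (G : BoundaryGluingData bM bN φ P)

/-- **Swapping the pieces**: `M ∪_φ N = N ∪_{φ⁻¹} M`. [folklore] -/
def symm : BoundaryGluingData bN bM φ.symm P where
  jA := G.jB
  jB := G.jA
  isSmoothEmbedding_jA := G.isSmoothEmbedding_jB
  isSmoothEmbedding_jB := G.isSmoothEmbedding_jA
  range_union := (union_comm _ _).trans G.range_union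
  jA_eq_jB_iff b a := by
    rw [eq_comm, G.jA_eq_jB_iff]
    constructor
    · rintro ⟨z, ha, hb⟩
      exact ⟨φ z, hb, by simpa using ha⟩
    · rintro ⟨w, hb, ha⟩
      exact ⟨φ.symm w, ha, by simpa using hb⟩

/-- Unfolding lemma (definitional). [folklore] -/
@[simp] theorem symm_jA : G.symm.jA = G.jB := rfl

/-- Unfolding lemma (definitional). [folklore] -/
@[simp] theorem symm_jB : G.symm.jB = G.jA := rfl

/-- `jA` is injective. [folklore] -/
theorem injective_jA : Injective G.jA := G.isSmoothEmbedding_jA.isEmbedding.injective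

/-- `jB` is injective. [folklore] -/
theorem injective_jB : Injective G.jB := G.isSmoothEmbedding_jB.isEmbedding.injective

/-- `jA` is continuous. [folklore] -/
theorem continuous_jA : Continuous G.jA := G.isSmoothEmbedding_jA.isEmbedding.continuous

/-- `jB` is continuous. [folklore] -/
theorem continuous_jB : Continuous G.jB := G.isSmoothEmbedding_jB.isEmbedding.continuous

/-- `jA` is smooth. [folklore] -/
theorem contMDiff_jA : ContMDiff (𝓡∂ (n + 1)) (𝓡 (n + 1)) ∞ G.jA :=
  G.isSmoothEmbedding_jA.contMDiff

/-- `jB` is smooth. [folklore] -/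
theorem contMDiff_jB : ContMDiff (𝓡∂ (n + 1)) (𝓡 (n + 1)) ∞ G.jB :=
  G.isSmoothEmbedding_jB.contMDiff

/-- The seam point of `z : ∂M`: `jA (incl z) = jB (incl (φ z))`. [folklore] -/
theorem jA_incl (z : bM.carrier) : G.jA (bM.incl z) = G.jB (bN.incl (φ z)) :=
  (G.jA_eq_jB_iff _ _).2 ⟨z, rfl, rfl⟩

/-- The seam point of `w : ∂N`: `jB (incl w) = jA (incl (φ⁻¹ w))`. [folklore] -/
theorem jB_incl (w : bN.carrier) : G.jB (bN.incl w) = G.jA (bM.incl (φ.symm w)) := by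
  rw [G.jA_incl, Equiv.apply_symm_apply]

/-- A point of `M` glued to a point of `N` is a boundary point. [folklore] -/
theorem mem_range_incl_of_jA_eq_jB {a : M} {b : N} (h : G.jA a = G.jB b) : a ∈ range bM.incl := by
  obtain ⟨z, rfl, -⟩ := (G.jA_eq_jB_iff a b).1 h
  exact mem_range_self z

/-- **The seam** `jA (∂M) = jB (∂N)` of the gluing. [folklore] -/
def seam : Set P := range (G.jA ∘ bM.incl)

/-- Seam points. [folklore] -/
theorem jA_incl_mem_seam (z : bM.carrier) : G.jA (bM.incl z) ∈ G.seam := ⟨z, rfl⟩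

/-- The seam is `range jA ∩ range jB`. [folklore] -/
theorem range_inter_range : range G.jA ∩ range G.jB = G.seam := by
  ext p
  constructor
  · rintro ⟨⟨a, rfl⟩, ⟨b, hb⟩⟩
    obtain ⟨z, rfl, -⟩ := (G.jA_eq_jB_iff a b).1 hb.symm
    exact ⟨z, rfl⟩
  · rintro ⟨z, rfl⟩
    exact ⟨⟨_, rfl⟩, ⟨bN.incl (φ z), (G.jA_incl z).symm⟩⟩

/-- The seam of the swapped data is the same set. [folklore] -/
@[simp] theorem symm_seam : G.symm.seam = G.seam := by
  rw [← range_inter_range, ← range_inter_range, inter_comm]; rfl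

/-- The seam is contained in the first piece. [folklore] -/
theorem seam_subset_range_jA : G.seam ⊆ range G.jA := by
  rw [← range_inter_range]; exact inter_subset_left

/-- The seam is contained in the second piece. [folklore] -/
theorem seam_subset_range_jB : G.seam ⊆ range G.jB := by
  rw [← range_inter_range]; exact inter_subset_right

/-- `jA a` lies on the seam iff `a` is a boundary point. [folklore] -/
theorem jA_mem_seam_iff (a : M) : G.jA a ∈ G.seam ↔ a ∈ range bM.incl := by
  constructor
  · rintro ⟨z, hz⟩
    exact ⟨z, G.injective_jA hz⟩
  · rintro ⟨z, rfl⟩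
    exact G.jA_incl_mem_seam z

/-- **The image of the interior of the first piece is the complement of the second piece.**
[folklore] -/
theorem image_jA_interior_eq_compl :
    G.jA '' (𝓡∂ (n + 1)).interior M = (range G.jB)ᶜ := by
  ext p
  constructor
  · rintro ⟨a, ha, rfl⟩ ⟨b, hb⟩
    have hmem := G.mem_range_incl_of_jA_eq_jB hb.symm
    rw [bM.range_incl, ← ModelWithCorners.compl_interior] at hmem
    exact hmem ha
  · intro hp
    have hpA : p ∈ range G.jA := by
      have := G.range_union.symm.subset (mem_univ p)
      exact this.resolve_right hp
    obtain ⟨a, rfl⟩ := hpA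
    refine ⟨a, ?_, rfl⟩
    by_contra ha
    have ha' : a ∈ (𝓡∂ (n + 1)).boundary M := by
      rw [← ModelWithCorners.compl_interior]; exact ha
    rw [← bM.range_incl] at ha'
    obtain ⟨z, rfl⟩ := ha'
    exact hp ⟨_, (G.jA_incl z).symm⟩

/-- A point off the second piece is the image of an interior point of the first. [folklore] -/
theorem exists_eq_jA_of_notMem_range_jB {p : P} (hp : p ∉ range G.jB) :
    ∃ a ∈ (𝓡∂ (n + 1)).interior M, G.jA a = p := by
  have : p ∈ G.jA '' (𝓡∂ (n + 1)).interior M := by rw [G.image_jA_interior_eq_compl]; exact hp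
  exact this

/-- Points of `P` are on the seam, in the image of `Int M`, or in the image of `Int N`.
[folklore] -/
theorem mem_seam_or (p : P) :
    p ∈ G.seam ∨ p ∈ G.jA '' (𝓡∂ (n + 1)).interior M ∨ p ∈ G.jB '' (𝓡∂ (n + 1)).interior N := by
  rw [G.image_jA_interior_eq_compl, show G.jB '' (𝓡∂ (n + 1)).interior N = (range G.jA)ᶜ from
    G.symm.image_jA_interior_eq_compl, ← range_inter_range]
  by_cases hA : p ∈ range G.jA <;> by_cases hB : p ∈ range G.jB <;> simp_all

end BoundaryGluingData

end Defs

/-! ### Immersion charts in equal dimensions: the half-space chart -/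

section HalfSpaceChart

variable {n : ℕ} {M : Type u} [TopologicalSpace M] [ChartedSpace (ℍ (n + 1)) M]
  {P : Type w} [TopologicalSpace P] [ChartedSpace (𝔼 (n + 1)) P] {j : M → P} {x : M}

/-- The **linear part** of Mathlib's immersion data of `j : M → P` at `x`, for `M` an
`(n+1)`-manifold with boundary and `P` an `(n+1)`-manifold without boundary:
`u ↦ h.equiv (u, 0)`, an injective linear endomorphism of `ℝⁿ⁺¹`, hence an automorphism.
(General-source version of the tree's `Manifold.IsImmersionAt.linearPart` of
`BallGluingCharts.lean`, which is typed for the closed disc; a deliberate dot-notation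
extension in Mathlib's namespace `Manifold.IsImmersionAt`.) [folklore] -/
def _root_.Manifold.IsImmersionAt.halfSpaceLinearPart
    (h : Manifold.IsImmersionAt (𝓡∂ (n + 1)) (𝓡 (n + 1)) ∞ j x) :
    (𝔼 (n + 1)) ≃L[ℝ] 𝔼 (n + 1) :=
  LinearEquiv.toContinuousLinearEquiv
    (LinearEquiv.ofInjectiveEndo
      ((h.equiv : (𝔼 (n + 1)) × h.complement →L[ℝ] 𝔼 (n + 1)).toLinearMap ∘ₗ
        LinearMap.inl ℝ (𝔼 (n + 1)) h.complement)
      (by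
        intro u v huv
        have : ((u, 0) : (𝔼 (n + 1)) × h.complement) = (v, 0) := h.equiv.injective huv
        exact congrArg Prod.fst this))

/-- The linear part is `u ↦ h.equiv (u, 0)` (definitional). [folklore] -/
@[simp]
theorem _root_.Manifold.IsImmersionAt.halfSpaceLinearPart_apply
    (h : Manifold.IsImmersionAt (𝓡∂ (n + 1)) (𝓡 (n + 1)) ∞ j x) (u : 𝔼 (n + 1)) :
    h.halfSpaceLinearPart u = h.equiv (u, 0) := rfl

/-- The **half-space chart** of `P` at `j x` attached to the immersion data of `j` at `x`: the
codomain chart followed by the inverse of the linear part.  In it, `j` reads as the domain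
chart: `halfSpaceChart (j y) = (domChart y).val` (`halfSpaceChart_apply_of_mem`).
(General-source version of the tree's `Manifold.IsImmersionAt.normalChart`; a deliberate
dot-notation extension in Mathlib's namespace.) [folklore] -/
def _root_.Manifold.IsImmersionAt.halfSpaceChart
    (h : Manifold.IsImmersionAt (𝓡∂ (n + 1)) (𝓡 (n + 1)) ∞ j x) :
    OpenPartialHomeomorph P (𝔼 (n + 1)) :=
  h.codChart ≫ₕ h.halfSpaceLinearPart.symm.toHomeomorph.toOpenPartialHomeomorph

/-- The half-space chart has the source of the codomain chart. [folklore] -/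
@[simp]
theorem _root_.Manifold.IsImmersionAt.halfSpaceChart_source
    (h : Manifold.IsImmersionAt (𝓡∂ (n + 1)) (𝓡 (n + 1)) ∞ j x) :
    h.halfSpaceChart.source = h.codChart.source := by
  simp [Manifold.IsImmersionAt.halfSpaceChart]

/-- Unfolding lemma for the half-space chart (definitional). [folklore] -/
theorem _root_.Manifold.IsImmersionAt.halfSpaceChart_apply
    (h : Manifold.IsImmersionAt (𝓡∂ (n + 1)) (𝓡 (n + 1)) ∞ j x) (p : P) :
    h.halfSpaceChart p = h.halfSpaceLinearPart.symm (h.codChart p) := rfl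

/-- `j` maps the source of the domain chart into the source of the half-space chart.
[folklore] -/
theorem _root_.Manifold.IsImmersionAt.mem_halfSpaceChart_source
    (h : Manifold.IsImmersionAt (𝓡∂ (n + 1)) (𝓡 (n + 1)) ∞ j x)
    {y : M} (hy : y ∈ h.domChart.source) : j y ∈ h.halfSpaceChart.source := by
  rw [Manifold.IsImmersionAt.halfSpaceChart_source]
  exact h.source_subset_preimage_source hy

/-- The half-space chart lies in the maximal atlas (it differs from the codomain chart by a
linear automorphism of the model). [folklore] -/
theorem _root_.Manifold.IsImmersionAt.halfSpaceChart_mem_maximalAtlas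
    [IsManifold (𝓡 (n + 1)) ∞ P] (h : Manifold.IsImmersionAt (𝓡∂ (n + 1)) (𝓡 (n + 1)) ∞ j x) :
    h.halfSpaceChart ∈ IsManifold.maximalAtlas (𝓡 (n + 1)) ∞ P := by
  refine trans_mem_maximalAtlas_of_contDiffOn h.codChart_mem_maximalAtlas _ ?_ ?_
  · exact h.halfSpaceLinearPart.symm.contDiff.contDiffOn
  · exact h.halfSpaceLinearPart.contDiff.contDiffOn

/-- **In the half-space chart, `j` is the domain chart**: `halfSpaceChart (j y) = (domChart y).val`
for `y` in the source of the domain chart (Mathlib's `writtenInCharts`, unwound). [folklore] -/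
theorem _root_.Manifold.IsImmersionAt.halfSpaceChart_apply_of_mem
    (h : Manifold.IsImmersionAt (𝓡∂ (n + 1)) (𝓡 (n + 1)) ∞ j x)
    {y : M} (hy : y ∈ h.domChart.source) :
    h.halfSpaceChart (j y) = (h.domChart y).val := by
  have hmem : (h.domChart.extend (𝓡∂ (n + 1))) y ∈ (h.domChart.extend (𝓡∂ (n + 1))).target :=
    (h.domChart.extend (𝓡∂ (n + 1))).map_source
      (by rw [OpenPartialHomeomorph.extend_source]; exact hy)
  have hw := h.writtenInCharts hmem
  simp only [comp_apply] at hw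
  rw [OpenPartialHomeomorph.extend_left_inv _ hy] at hw
  have h1 : (h.codChart.extend (𝓡 (n + 1))) (j y) = h.codChart (j y) := by
    rw [OpenPartialHomeomorph.extend_coe, comp_apply, modelWithCornersSelf_coe, id]
  have h2 : (h.domChart.extend (𝓡∂ (n + 1))) y = (h.domChart y).val := rfl
  rw [h1, h2] at hw
  rw [Manifold.IsImmersionAt.halfSpaceChart_apply, ContinuousLinearEquiv.symm_apply_eq,
    Manifold.IsImmersionAt.halfSpaceLinearPart_apply, hw]

/-- The extended target of the domain chart, through the half-space chart, consists of values
of `j`: `halfSpaceChart.symm e = j (domChart.symm e)` for `e` in the extended target.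
[folklore] -/
theorem _root_.Manifold.IsImmersionAt.halfSpaceChart_symm_apply_of_mem
    (h : Manifold.IsImmersionAt (𝓡∂ (n + 1)) (𝓡 (n + 1)) ∞ j x)
    {e : 𝔼 (n + 1)} (he : e ∈ (h.domChart.extend (𝓡∂ (n + 1))).target) :
    h.halfSpaceChart.symm e = j ((h.domChart.extend (𝓡∂ (n + 1))).symm e) := by
  set y := (h.domChart.extend (𝓡∂ (n + 1))).symm e with hy_def
  have hy : y ∈ h.domChart.source := by
    rw [← OpenPartialHomeomorph.extend_source (I := 𝓡∂ (n + 1))]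
    exact (h.domChart.extend (𝓡∂ (n + 1))).map_target he
  have h1 : h.halfSpaceChart (j y) = e := by
    rw [h.halfSpaceChart_apply_of_mem hy]
    have : (h.domChart.extend (𝓡∂ (n + 1))) y = e :=
      (h.domChart.extend (𝓡∂ (n + 1))).right_inv he
    exact this
  rw [← h1, OpenPartialHomeomorph.left_inv _ (h.mem_halfSpaceChart_source hy)]

/-- **An equidimensional smooth embedding is open on interior points**: if `j : M → P` is a
smooth embedding of an `(n+1)`-manifold with boundary into an `(n+1)`-manifold without
boundary, then the image of an open set `U` of interior points of `M` is open in `P` (in the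
half-space chart at `j x`, `j` is a chart of `M`, which sends interior points to the open half
space by invariance of the boundary).  No separation hypothesis on `P` is needed. [folklore] -/
theorem isOpen_image_of_isSmoothEmbedding_of_subset_interior [IsManifold (𝓡∂ (n + 1)) ∞ M]
    [IsManifold (𝓡 (n + 1)) ∞ P]
    (hj : Manifold.IsSmoothEmbedding (𝓡∂ (n + 1)) (𝓡 (n + 1)) ∞ j) {U : Set M} (hU : IsOpen U)
    (hUi : U ⊆ (𝓡∂ (n + 1)).interior M) : IsOpen (j '' U) := by
  rw [isOpen_iff_mem_nhds]
  rintro _ ⟨x, hx, rfl⟩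
  have h : Manifold.IsImmersionAt (𝓡∂ (n + 1)) (𝓡 (n + 1)) ∞ j x :=
    hj.isImmersion.isImmersionAt x
  set φ := h.domChart.extend (𝓡∂ (n + 1)) with hφ
  -- the open piece `W` of the extended target consisting of interior values coming from `U`
  set W : Set (𝔼 (n + 1)) := interior φ.target ∩ φ.symm ⁻¹' U with hW
  have hWo : IsOpen W :=
    ((h.domChart.continuousOn_extend_symm (I := 𝓡∂ (n + 1))).mono interior_subset).isOpen_inter_preimage
      isOpen_interior hU
  have hxW : φ x ∈ W := by
    have hint : (𝓡∂ (n + 1)).IsInteriorPoint x := hUi hx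
    rw [isInteriorPoint_iff_of_mem_maximalAtlas (by simp) h.domChart_mem_maximalAtlas
      h.mem_domChart_source] at hint
    refine ⟨h.domChart.mem_interior_extend_target (h.domChart.map_source h.mem_domChart_source)
      hint, ?_⟩
    rw [mem_preimage, hφ, h.domChart.extend_left_inv (I := 𝓡∂ (n + 1)) h.mem_domChart_source]
    exact hx
  -- the extended target lies in the target of the half-space chart
  have htarget : φ.target ⊆ h.halfSpaceChart.target := fun e he => by
    have hy : φ.symm e ∈ h.domChart.source := by
      rw [← OpenPartialHomeomorph.extend_source (I := 𝓡∂ (n + 1))]; exact φ.map_target he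
    have h1 := h.halfSpaceChart.map_source (h.mem_halfSpaceChart_source hy)
    rw [h.halfSpaceChart_apply_of_mem hy] at h1
    have h2 : (h.domChart (φ.symm e)).val = e := φ.right_inv he
    rwa [h2] at h1
  -- the image of `W` under the inverse half-space chart is an open neighbourhood of `j x`
  -- inside `j '' U`
  refine mem_nhds_iff.2 ⟨h.halfSpaceChart.symm '' W, ?_, ?_, ?_⟩
  · rintro _ ⟨e, ⟨he, heU⟩, rfl⟩
    exact ⟨φ.symm e, heU, (h.halfSpaceChart_symm_apply_of_mem (interior_subset he)).symm⟩
  · exact h.halfSpaceChart.symm.isOpen_image_of_subset_source hWo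
      (by rw [h.halfSpaceChart.symm_source]
          exact (inter_subset_left.trans (interior_subset.trans htarget)))
  · refine ⟨φ x, hxW, ?_⟩
    change h.halfSpaceChart.symm (h.domChart x).val = j x
    rw [← h.halfSpaceChart_apply_of_mem h.mem_domChart_source]
    exact h.halfSpaceChart.left_inv (h.mem_halfSpaceChart_source h.mem_domChart_source)

/-- In particular the image of the interior of `M` under an equidimensional smooth embedding
is open. [folklore] -/
theorem isOpen_image_interior_of_isSmoothEmbedding [IsManifold (𝓡∂ (n + 1)) ∞ M]
    [IsManifold (𝓡 (n + 1)) ∞ P]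
    (hj : Manifold.IsSmoothEmbedding (𝓡∂ (n + 1)) (𝓡 (n + 1)) ∞ j) :
    IsOpen (j '' (𝓡∂ (n + 1)).interior M) :=
  isOpen_image_of_isSmoothEmbedding_of_subset_interior hj
    (ModelWithCorners.isOpen_interior (I := 𝓡∂ (n + 1)) (M := M) (n := ∞) (by simp)) Subset.rfl

/-- An equidimensional smooth embedding is **open at interior points**: it maps neighbourhoods
of an interior point to neighbourhoods. [folklore] -/
theorem image_mem_nhds_of_isSmoothEmbedding_of_mem_interior [IsManifold (𝓡∂ (n + 1)) ∞ M]
    [IsManifold (𝓡 (n + 1)) ∞ P]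
    (hj : Manifold.IsSmoothEmbedding (𝓡∂ (n + 1)) (𝓡 (n + 1)) ∞ j) {x : M}
    (hx : x ∈ (𝓡∂ (n + 1)).interior M) {U : Set M} (hU : U ∈ 𝓝 x) : j '' U ∈ 𝓝 (j x) := by
  have hIo : IsOpen ((𝓡∂ (n + 1)).interior M) :=
    ModelWithCorners.isOpen_interior (I := 𝓡∂ (n + 1)) (M := M) (n := ∞) (by simp)
  refine mem_of_superset ((isOpen_image_of_isSmoothEmbedding_of_subset_interior hj
    (isOpen_interior.inter hIo) inter_subset_right).mem_nhds
    ⟨x, ⟨mem_interior_iff_mem_nhds.2 hU, hx⟩, rfl⟩) (image_mono ?_)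
  exact inter_subset_left.trans interior_subset

/-! ### Relation with the disc versions

On a disc `j : 𝔻ⁿ⁺¹ → P` (a charted space over `ℍ (n + 1)`, `ClosedBall.lean`) the general
`halfSpaceLinearPart` / `halfSpaceChart` above are *the same terms* as the tree's earlier disc
versions `Manifold.IsImmersionAt.linearPart` / `normalChart` (`BallGluingCharts.lean`), which
they supersede (refactor: the disc versions can be replaced by these). -/

section Disc

/-- Local notation: `𝔻 n` is the closed unit ball of `EuclideanSpace ℝ (Fin n)` (a subtype). -/
local notation "𝔻 " n:arg => (Metric.closedBall (0 : EuclideanSpace ℝ (Fin n)) 1)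

variable {n : ℕ} {P : Type w} [TopologicalSpace P] [ChartedSpace (𝔼 (n + 1)) P]
  {j : (𝔻 (n + 1)) → P} {x : 𝔻 (n + 1)}

/-- On a disc, `halfSpaceLinearPart` is the tree's `linearPart` (definitional). [folklore] -/
theorem _root_.Manifold.IsImmersionAt.halfSpaceLinearPart_eq_linearPart
    (h : Manifold.IsImmersionAt (𝓡∂ (n + 1)) (𝓡 (n + 1)) ∞ j x) :
    h.halfSpaceLinearPart = h.linearPart := rfl

/-- On a disc, `halfSpaceChart` is the tree's `normalChart` (definitional). [folklore] -/
theorem _root_.Manifold.IsImmersionAt.halfSpaceChart_eq_normalChart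
    (h : Manifold.IsImmersionAt (𝓡∂ (n + 1)) (𝓡 (n + 1)) ∞ j x) :
    h.halfSpaceChart = h.normalChart := rfl

end Disc

end HalfSpaceChart

/-! ### Closed pieces, separation, compactness -/

section Topology

variable {n : ℕ} {M N : Type u} [TopologicalSpace M] [ChartedSpace (ℍ (n + 1)) M]
  [TopologicalSpace N] [ChartedSpace (ℍ (n + 1)) N]
  {bM : BoundaryData (𝓡∂ (n + 1)) M (𝓡 n)} {bN : BoundaryData (𝓡∂ (n + 1)) N (𝓡 n)}
  {φ : bM.carrier ≃ bN.carrier}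
  {P : Type w} [TopologicalSpace P] [ChartedSpace (𝔼 (n + 1)) P]
  (G : BoundaryGluingData bM bN φ P)

namespace BoundaryGluingData

/-- The image of the interior of the first piece is open. [folklore] -/
theorem isOpen_image_jA_interior [IsManifold (𝓡∂ (n + 1)) ∞ M] [IsManifold (𝓡 (n + 1)) ∞ P] :
    IsOpen (G.jA '' (𝓡∂ (n + 1)).interior M) :=
  isOpen_image_interior_of_isSmoothEmbedding G.isSmoothEmbedding_jA

/-- The image of the interior of the second piece is open. [folklore] -/
theorem isOpen_image_jB_interior [IsManifold (𝓡∂ (n + 1)) ∞ N] [IsManifold (𝓡 (n + 1)) ∞ P] :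
    IsOpen (G.jB '' (𝓡∂ (n + 1)).interior N) :=
  G.symm.isOpen_image_jA_interior

/-- **The second piece is closed** (its complement is the open image of `Int M`; no separation
hypothesis is used). [folklore] -/
theorem isClosed_range_jB [IsManifold (𝓡∂ (n + 1)) ∞ M] [IsManifold (𝓡 (n + 1)) ∞ P] :
    IsClosed (range G.jB) := by
  rw [← compl_compl (range G.jB), ← G.image_jA_interior_eq_compl]
  exact G.isOpen_image_jA_interior.isClosed_compl

/-- **The first piece is closed.** [folklore] -/
theorem isClosed_range_jA [IsManifold (𝓡∂ (n + 1)) ∞ N] [IsManifold (𝓡 (n + 1)) ∞ P] :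
    IsClosed (range G.jA) :=
  G.symm.isClosed_range_jB

variable [IsManifold (𝓡∂ (n + 1)) ∞ M] [IsManifold (𝓡∂ (n + 1)) ∞ N] [IsManifold (𝓡 (n + 1)) ∞ P]

/-- The seam is closed. [folklore] -/
theorem isClosed_seam : IsClosed G.seam := by
  rw [← range_inter_range]; exact G.isClosed_range_jA.inter G.isClosed_range_jB

omit [IsManifold (𝓡∂ (n + 1)) ∞ M] in
/-- `jA` is a closed embedding. [folklore] -/
theorem isClosedEmbedding_jA : IsClosedEmbedding G.jA :=
  ⟨G.isSmoothEmbedding_jA.isEmbedding, G.isClosed_range_jA⟩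

omit [IsManifold (𝓡∂ (n + 1)) ∞ N] in
/-- `jB` is a closed embedding. [folklore] -/
theorem isClosedEmbedding_jB : IsClosedEmbedding G.jB :=
  ⟨G.isSmoothEmbedding_jB.isEmbedding, G.isClosed_range_jB⟩

/-- **Closed-cover criterion**: a subset of `P` whose traces on both pieces are closed is
closed. [folklore] -/
theorem isClosed_of_preimage {C : Set P} (hA : IsClosed (G.jA ⁻¹' C))
    (hB : IsClosed (G.jB ⁻¹' C)) : IsClosed C := by
  have hC : C = G.jA '' (G.jA ⁻¹' C) ∪ G.jB '' (G.jB ⁻¹' C) := by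
    rw [image_preimage_eq_inter_range, image_preimage_eq_inter_range, ← inter_union_distrib_left,
      G.range_union, inter_univ]
  rw [hC]
  exact (G.isClosedEmbedding_jA.isClosedMap _ hA).union (G.isClosedEmbedding_jB.isClosedMap _ hB)

/-- **Open-cover criterion**: a subset of `P` whose traces on both pieces are open is open.
[folklore] -/
theorem isOpen_of_preimage {U : Set P} (hA : IsOpen (G.jA ⁻¹' U)) (hB : IsOpen (G.jB ⁻¹' U)) :
    IsOpen U := by
  rw [← isClosed_compl_iff]
  exact G.isClosed_of_preimage (by rw [preimage_compl]; exact hA.isClosed_compl)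
    (by rw [preimage_compl]; exact hB.isClosed_compl)

/-- **A gluing of Hausdorff pieces is Hausdorff.** Given `p ≠ q`, either both lie in the domain
of a chart at `p` (and are separated there), or a closed chart ball `C` about `p` misses `q`;
`C` is closed in `P` because `jA ⁻¹' C`, `jB ⁻¹' C` are compact (the pieces are closed and
embedded) in the Hausdorff spaces `M`, `N`.  This is why the named fact
`nonempty_diffeomorph_of_isBoundaryGluing` carries no separation hypothesis on `P`. [folklore] -/
theorem t2Space (G : BoundaryGluingData bM bN φ P) [T2Space M] [T2Space N] : T2Space P := by
  refine ⟨fun p q hpq => ?_⟩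
  set κ := chartAt (𝔼 (n + 1)) p with hκ
  have hp : p ∈ κ.source := mem_chart_source _ p
  by_cases hq : q ∈ κ.source
  · have hne : κ p ≠ κ q := fun h => hpq (κ.injOn hp hq h)
    obtain ⟨u, v, hu, hv, hpu, hqv, huv⟩ := t2_separation hne
    refine ⟨κ.source ∩ κ ⁻¹' u, κ.source ∩ κ ⁻¹' v, κ.isOpen_inter_preimage hu,
      κ.isOpen_inter_preimage hv, ⟨hp, hpu⟩, ⟨hq, hqv⟩, ?_⟩
    exact Set.disjoint_left.2 fun x hxu hxv => Set.disjoint_left.1 huv hxu.2 hxv.2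
  · obtain ⟨r, hr, hball⟩ : ∃ r > 0, closedBall (κ p) r ⊆ κ.target :=
      nhds_basis_closedBall.mem_iff.1 (κ.open_target.mem_nhds (κ.map_source hp))
    set C : Set P := κ.symm '' closedBall (κ p) r with hC
    have hCsrc : C ⊆ κ.source := by
      rintro _ ⟨e, he, rfl⟩; exact κ.map_target (hball he)
    have hCc : IsCompact C :=
      (isCompact_closedBall _ _).image_of_continuousOn (κ.continuousOn_symm.mono hball)
    have hCclosed : IsClosed C := by
      refine G.isClosed_of_preimage ?_ ?_
      · exact (G.isClosedEmbedding_jA.isInducing.isCompact_preimage G.isClosed_range_jA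
          hCc).isClosed
      · exact (G.isClosedEmbedding_jB.isInducing.isCompact_preimage G.isClosed_range_jB
          hCc).isClosed
    refine ⟨κ.source ∩ κ ⁻¹' ball (κ p) r, Cᶜ, κ.isOpen_inter_preimage isOpen_ball,
      hCclosed.isOpen_compl, ⟨hp, mem_ball_self hr⟩, fun hqC => hq (hCsrc hqC), ?_⟩
    refine Set.disjoint_left.2 fun x hx hxC => hxC ?_
    exact ⟨κ x, ball_subset_closedBall hx.2, κ.left_inv hx.1⟩

omit [IsManifold (𝓡∂ (n + 1)) ∞ M] [IsManifold (𝓡∂ (n + 1)) ∞ N] [IsManifold (𝓡 (n + 1)) ∞ P] in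
/-- A gluing of compact pieces is compact. [folklore] -/
theorem compactSpace (G : BoundaryGluingData bM bN φ P) [CompactSpace M] [CompactSpace N] :
    CompactSpace P :=
  IsBoundaryGluing.compactSpace G.isBoundaryGluing

/-- The seam of a gluing of compact pieces is compact. [folklore] -/
theorem isCompact_seam [CompactSpace M] [CompactSpace N] : IsCompact G.seam := by
  haveI := G.compactSpace
  exact G.isClosed_seam.isCompact

end BoundaryGluingData

end Topology

/-! ### Flat charts at seam points -/

section FlatChart

variable {n : ℕ} {M N : Type u} [TopologicalSpace M] [ChartedSpace (ℍ (n + 1)) M]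
  [TopologicalSpace N] [ChartedSpace (ℍ (n + 1)) N]
  {bM : BoundaryData (𝓡∂ (n + 1)) M (𝓡 n)} {bN : BoundaryData (𝓡∂ (n + 1)) N (𝓡 n)}
  {φ : bM.carrier ≃ bN.carrier}
  {P : Type w} [TopologicalSpace P] [ChartedSpace (𝔼 (n + 1)) P]

namespace BoundaryGluingData

/-- **A flat chart of the gluing at the seam point of `z : ∂M`**: a chart `chart` of the
maximal `C^∞` atlas of `P` about `jA (incl z)` together with a chart `domChart` of the maximal
atlas of `M` about `incl z` such that `jA ⁻¹' chart.source = domChart.source` and in these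
charts `jA` is the inclusion of the half space, `chart (jA y) = (domChart y).val`; moreover the
target of `chart` lies in a ball about the image of the seam point whose closed upper half
consists of values of `domChart`.  Consequently (lemmas below) `chart` reads `range jA` as
`{0 ≤ u 0}`, the seam as `{u 0 = 0}` and the other piece as `{u 0 ≤ 0}`.  Existence:
`nonempty_flatChart`.  Hirsch (1976), Ch. 1 §4 and Ch. 8 §2 (the pieces are closed
submanifolds meeting along `V = ∂M = ∂N`). [folklore] -/
structure FlatChart (G : BoundaryGluingData bM bN φ P) (z : bM.carrier) where
  /-- The chart of `P`. -/
  chart : OpenPartialHomeomorph P (𝔼 (n + 1))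
  /-- It lies in the maximal `C^∞` atlas of `P`. -/
  mem_maximalAtlas : chart ∈ IsManifold.maximalAtlas (𝓡 (n + 1)) ∞ P
  /-- The chart of `M` through which `jA` is read. -/
  domChart : OpenPartialHomeomorph M (ℍ (n + 1))
  /-- It lies in the maximal `C^∞` atlas of `M`. -/
  domChart_mem_maximalAtlas : domChart ∈ IsManifold.maximalAtlas (𝓡∂ (n + 1)) ∞ M
  /-- The seam point lies in the source of the domain chart. -/
  incl_mem_source : bM.incl z ∈ domChart.source
  /-- The trace of the source on the first piece is exactly the source of the domain chart. -/
  preimage_source : G.jA ⁻¹' chart.source = domChart.source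
  /-- In the two charts `jA` is the inclusion of the half space. -/
  chart_jA : ∀ y ∈ domChart.source, chart (G.jA y) = (domChart y).val
  /-- The radius of a ball containing the target. -/
  radius : ℝ
  /-- The radius is positive. -/
  radius_pos : 0 < radius
  /-- The target lies in the ball about the image of the seam point. -/
  target_subset : chart.target ⊆ ball (chart (G.jA (bM.incl z))) radius
  /-- The closed upper half of that ball consists of values of the domain chart. -/
  inter_subset : ball (chart (G.jA (bM.incl z))) radius ∩ {u | 0 ≤ u 0} ⊆
    Subtype.val '' domChart.target

namespace FlatChart

variable {G : BoundaryGluingData bM bN φ P} {z : bM.carrier} (F : G.FlatChart z)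

/-- The seam point lies in the source of a flat chart. [folklore] -/
theorem mem_source : G.jA (bM.incl z) ∈ F.chart.source := by
  rw [← mem_preimage, F.preimage_source]; exact F.incl_mem_source

/-- The **centre** of a flat chart: the image of the seam point. [folklore] -/
def center : 𝔼 (n + 1) := F.chart (G.jA (bM.incl z))

/-- Unfolding lemma (definitional). [folklore] -/
theorem center_def : F.center = F.chart (G.jA (bM.incl z)) := rfl

/-- The centre is the value of the domain chart at `incl z`. [folklore] -/
theorem center_eq : F.center = (F.domChart (bM.incl z)).val := F.chart_jA _ F.incl_mem_source

/-- The centre lies in the target. [folklore] -/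
theorem center_mem_target : F.center ∈ F.chart.target := F.chart.map_source F.mem_source

/-- Points of the first piece in the source come from the source of the domain chart.
[folklore] -/
theorem mem_domChart_source {y : M} (hy : G.jA y ∈ F.chart.source) : y ∈ F.domChart.source := by
  rw [← F.preimage_source]; exact hy

/-- Points of the source of the domain chart are mapped into the source. [folklore] -/
theorem jA_mem_source {y : M} (hy : y ∈ F.domChart.source) : G.jA y ∈ F.chart.source := by
  rw [← mem_preimage, F.preimage_source]; exact hy

/-- A flat chart is `C^∞` on its source. [folklore] -/
theorem contMDiffOn [IsManifold (𝓡 (n + 1)) ∞ P] :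
    ContMDiffOn (𝓡 (n + 1)) 𝓘(ℝ, 𝔼 (n + 1)) ∞ F.chart F.chart.source :=
  contMDiffOn_of_mem_maximalAtlas F.mem_maximalAtlas

/-- The inverse of a flat chart is `C^∞` on its target. [folklore] -/
theorem contMDiffOn_symm [IsManifold (𝓡 (n + 1)) ∞ P] :
    ContMDiffOn 𝓘(ℝ, 𝔼 (n + 1)) (𝓡 (n + 1)) ∞ F.chart.symm F.chart.target :=
  contMDiffOn_symm_of_mem_maximalAtlas F.mem_maximalAtlas

/-- **Values of the upper half ball are values of `jA`**: for `u` in the target with `0 ≤ u 0`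
there is `y` in the source of the domain chart with `(domChart y).val = u` and
`jA y = chart.symm u`. [folklore] -/
theorem exists_eq_of_nonneg {u : 𝔼 (n + 1)} (hu : u ∈ F.chart.target) (hu0 : 0 ≤ u 0) :
    ∃ y ∈ F.domChart.source, (F.domChart y).val = u ∧ G.jA y = F.chart.symm u := by
  obtain ⟨w, hw, hwu⟩ := F.inter_subset ⟨F.target_subset hu, hu0⟩
  have hy : F.domChart.symm w ∈ F.domChart.source := F.domChart.map_target hw
  have hval : (F.domChart (F.domChart.symm w)).val = u := by rw [F.domChart.right_inv hw]; exact hwu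
  refine ⟨F.domChart.symm w, hy, hval, ?_⟩
  rw [F.chart.eq_symm_apply (F.jA_mem_source hy) hu, F.chart_jA _ hy, hval]

/-- **`range jA` is read as the closed upper half space.** [folklore] -/
theorem nonneg_iff {p : P} (hp : p ∈ F.chart.source) : 0 ≤ F.chart p 0 ↔ p ∈ range G.jA := by
  constructor
  · intro h0
    obtain ⟨y, -, -, hy⟩ := F.exists_eq_of_nonneg (F.chart.map_source hp) h0
    exact ⟨y, by rw [hy, F.chart.left_inv hp]⟩
  · rintro ⟨y, rfl⟩
    rw [F.chart_jA y (F.mem_domChart_source hp)]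
    exact (F.domChart y).2

/-- **The complement of `range jA` is read as the open lower half space.** [folklore] -/
theorem neg_iff {p : P} (hp : p ∈ F.chart.source) : F.chart p 0 < 0 ↔ p ∉ range G.jA := by
  rw [← not_le, F.nonneg_iff hp]

variable [IsManifold (𝓡∂ (n + 1)) ∞ M]

/-- In the domain chart, boundary points are exactly the points of height `0`. [folklore] -/
theorem domChart_apply_zero_eq_zero_iff {y : M} (hy : y ∈ F.domChart.source) :
    (F.domChart y).val 0 = 0 ↔ y ∈ range bM.incl := by
  rw [bM.range_incl, ← ModelWithCorners.compl_interior, mem_compl_iff]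
  change _ ↔ ¬ (𝓡∂ (n + 1)).IsInteriorPoint y
  rw [isInteriorPoint_iff_of_mem_maximalAtlas (by simp) F.domChart_mem_maximalAtlas hy,
    interior_range_modelWithCornersEuclideanHalfSpace]
  change _ ↔ ¬ (0 < (F.domChart y).val 0)
  have := (F.domChart y).2
  constructor
  · intro h; rw [h]; exact lt_irrefl 0
  · intro h; exact le_antisymm (not_lt.1 h) this

/-- **The seam is read as the hyperplane `{u 0 = 0}`.** [folklore] -/
theorem eq_zero_iff {p : P} (hp : p ∈ F.chart.source) : F.chart p 0 = 0 ↔ p ∈ G.seam := by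
  constructor
  · intro h0
    obtain ⟨y, rfl⟩ := (F.nonneg_iff hp).1 h0.ge
    rw [G.jA_mem_seam_iff, ← F.domChart_apply_zero_eq_zero_iff (F.mem_domChart_source hp),
      ← F.chart_jA y (F.mem_domChart_source hp), h0]
  · rintro ⟨w, rfl⟩
    have hy : bM.incl w ∈ F.domChart.source := F.mem_domChart_source hp
    show F.chart (G.jA (bM.incl w)) 0 = 0
    rw [F.chart_jA _ hy, F.domChart_apply_zero_eq_zero_iff hy]
    exact mem_range_self w

/-- The centre of a flat chart lies on the hyperplane. [folklore] -/
theorem center_zero : F.center 0 = 0 := (F.eq_zero_iff F.mem_source).2 (G.jA_incl_mem_seam z)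

/-- **`jA (Int M)` is read as the open upper half space.** [folklore] -/
theorem pos_iff {p : P} (hp : p ∈ F.chart.source) :
    0 < F.chart p 0 ↔ p ∈ G.jA '' (𝓡∂ (n + 1)).interior M := by
  rw [lt_iff_le_and_ne, F.nonneg_iff hp, ne_comm, Ne, F.eq_zero_iff hp]
  constructor
  · rintro ⟨⟨y, rfl⟩, hs⟩
    refine ⟨y, ?_, rfl⟩
    rw [G.jA_mem_seam_iff, bM.range_incl, ← ModelWithCorners.compl_interior, mem_compl_iff,
      not_not] at hs
    exact hs
  · rintro ⟨y, hy, rfl⟩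
    refine ⟨mem_range_self y, ?_⟩
    rw [G.jA_mem_seam_iff, bM.range_incl, ← ModelWithCorners.compl_interior, mem_compl_iff,
      not_not]
    exact hy

end FlatChart

/-- **Flat charts exist at every seam point.** Take Mathlib's immersion data of `jA` at
`incl z`; in the half-space chart (`Manifold.IsImmersionAt.halfSpaceChart`) `jA` is the domain
chart; shrink the source to a ball inside an open set `O` of `P` with
`jA ⁻¹' O = domChart.source` (the embedding `jA`) small enough that the closed upper half
ball lies in the extended target of the domain chart. [folklore] -/
theorem nonempty_flatChart [IsManifold (𝓡∂ (n + 1)) ∞ M] [IsManifold (𝓡 (n + 1)) ∞ P]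
    (G : BoundaryGluingData bM bN φ P) (z : bM.carrier) : Nonempty (G.FlatChart z) := by
  have h : Manifold.IsImmersionAt (𝓡∂ (n + 1)) (𝓡 (n + 1)) ∞ G.jA (bM.incl z) :=
    G.isSmoothEmbedding_jA.isImmersion.isImmersionAt _
  set κ₁ := h.halfSpaceChart with hκ₁
  set ψ := h.domChart.extend (𝓡∂ (n + 1)) with hψ
  set e₀ : 𝔼 (n + 1) := ψ (bM.incl z) with he₀
  have he₀' : κ₁ (G.jA (bM.incl z)) = e₀ := h.halfSpaceChart_apply_of_mem h.mem_domChart_source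
  -- Step 1: an open set `O` of `P` with `jA ⁻¹' O = domChart.source`
  obtain ⟨O, hO, hOe⟩ := G.isSmoothEmbedding_jA.isEmbedding.isInducing.isOpen_iff.1
    h.domChart.open_source
  -- Step 2: a ball whose upper half lies in the extended target of the domain chart
  obtain ⟨r₁, hr₁, hball₁⟩ : ∃ r₁ > 0, ball e₀ r₁ ∩ range (𝓡∂ (n + 1)) ⊆ ψ.target :=
    Metric.mem_nhdsWithin_iff.1 (h.domChart.extend_target_mem_nhdsWithin h.mem_domChart_source)
  -- Step 3: a ball inside the target of `κ₁` whose preimage lies in `O`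
  have hV : IsOpen (κ₁.target ∩ κ₁.symm ⁻¹' O) := κ₁.symm.isOpen_inter_preimage hO
  have he₀V : e₀ ∈ κ₁.target ∩ κ₁.symm ⁻¹' O := by
    rw [← he₀']
    refine ⟨κ₁.map_source (h.mem_halfSpaceChart_source h.mem_domChart_source), ?_⟩
    rw [mem_preimage, κ₁.left_inv (h.mem_halfSpaceChart_source h.mem_domChart_source),
      ← mem_preimage, hOe]
    exact h.mem_domChart_source
  obtain ⟨r₂, hr₂, hball₂⟩ := Metric.isOpen_iff.1 hV e₀ he₀V
  set r := min r₁ r₂ with hr_def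
  have hr : 0 < r := lt_min hr₁ hr₂
  -- Step 4: the restricted charts
  set t : Set P := O ∩ (κ₁.source ∩ κ₁ ⁻¹' ball e₀ r) with ht_def
  have hto : IsOpen t := hO.inter (κ₁.isOpen_inter_preimage isOpen_ball)
  have hmem_t : ∀ {p : P}, p ∈ (κ₁.restr t).source ↔
      p ∈ κ₁.source ∧ p ∈ O ∧ κ₁ p ∈ ball e₀ r := by
    intro p
    rw [κ₁.restr_source' t hto, ht_def]
    simp only [mem_inter_iff, mem_preimage]
    tauto
  have hdo : IsOpen (G.jA ⁻¹' (κ₁.restr t).source) :=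
    (κ₁.restr t).open_source.preimage G.continuous_jA
  set d := h.domChart.restr (G.jA ⁻¹' (κ₁.restr t).source) with hd
  have hsub : G.jA ⁻¹' (κ₁.restr t).source ⊆ h.domChart.source := by
    intro y hy
    rw [mem_preimage, hmem_t] at hy
    rw [← hOe]
    exact hy.2.1
  have hd_source : d.source = G.jA ⁻¹' (κ₁.restr t).source := by
    rw [hd, h.domChart.restr_source' _ hdo, inter_eq_right]
    exact hsub
  -- values of the domain chart in the upper half ball come from `d.source`
  have hup : ∀ u ∈ ball e₀ r, 0 ≤ u 0 → ∃ w ∈ d.source, (h.domChart w).val = u := by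
    intro u hu hu0
    have hut : u ∈ ψ.target := by
      refine hball₁ ⟨ball_subset_ball (min_le_left _ _) hu, ?_⟩
      rw [range_modelWithCornersEuclideanHalfSpace]
      exact hu0
    have hw : ψ.symm u ∈ h.domChart.source := by
      rw [← OpenPartialHomeomorph.extend_source (I := 𝓡∂ (n + 1))]; exact ψ.map_target hut
    have hval : (h.domChart (ψ.symm u)).val = u := ψ.right_inv hut
    refine ⟨ψ.symm u, ?_, hval⟩
    rw [hd_source, mem_preimage, hmem_t]
    refine ⟨h.mem_halfSpaceChart_source hw, ?_, ?_⟩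
    · rw [← mem_preimage, hOe]; exact hw
    · rw [h.halfSpaceChart_apply_of_mem hw, hval]; exact hu
  refine ⟨{ chart := κ₁.restr t
            mem_maximalAtlas := restr_mem_maximalAtlas _ h.halfSpaceChart_mem_maximalAtlas hto
            domChart := d
            domChart_mem_maximalAtlas := restr_mem_maximalAtlas _ h.domChart_mem_maximalAtlas hdo
            incl_mem_source := ?_
            preimage_source := hd_source.symm
            chart_jA := ?_
            radius := r
            radius_pos := hr
            target_subset := ?_
            inter_subset := ?_ }⟩
  · rw [hd_source, mem_preimage, hmem_t]
    refine ⟨h.mem_halfSpaceChart_source h.mem_domChart_source, ?_, ?_⟩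
    · rw [← mem_preimage, hOe]; exact h.mem_domChart_source
    · rw [he₀']; exact mem_ball_self hr
  · intro y hy
    rw [hd_source] at hy
    exact h.halfSpaceChart_apply_of_mem (hsub hy)
  · intro u hu
    rw [OpenPartialHomeomorph.restr_target, mem_inter_iff, mem_preimage, hto.interior_eq] at hu
    have h1 : κ₁ (κ₁.symm u) ∈ ball e₀ r := hu.2.2.2
    rw [κ₁.right_inv hu.1] at h1
    change u ∈ ball (κ₁ (G.jA (bM.incl z))) r
    rw [he₀']
    exact h1
  · rintro u ⟨hu, hu0⟩
    change u ∈ ball (κ₁ (G.jA (bM.incl z))) r at hu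
    rw [he₀'] at hu
    obtain ⟨w, hw, hwu⟩ := hup u hu hu0
    exact ⟨h.domChart w, d.map_source hw, hwu⟩

end BoundaryGluingData

end FlatChart

/-! ### Smoothness into a manifold with boundary, tested through an immersion -/

section Lift

variable {𝕜 : Type*} [NontriviallyNormedField 𝕜]
  {EX HX EM HM HN : Type*} {EN : Type u}
  [NormedAddCommGroup EX] [NormedSpace 𝕜 EX] [TopologicalSpace HX] {IX : ModelWithCorners 𝕜 EX HX}
  [NormedAddCommGroup EM] [NormedSpace 𝕜 EM] [TopologicalSpace HM] {IM : ModelWithCorners 𝕜 EM HM}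
  [NormedAddCommGroup EN] [NormedSpace 𝕜 EN] [TopologicalSpace HN] {IN : ModelWithCorners 𝕜 EN HN}
  {X : Type*} [TopologicalSpace X] [ChartedSpace HX X]
  {M' : Type*} [TopologicalSpace M'] [ChartedSpace HM M']
  {N' : Type*} [TopologicalSpace N'] [ChartedSpace HN N']
  {m : WithTop ℕ∞}

/-- **Smoothness within a set is tested after composition with an immersion**: a map
`f : X → M'` is `C^m` within `s` at `x` iff it is continuous within `s` at `x` and `ψ ∘ f` is
`C^m` within `s` at `x`, for any map `ψ` which is a `C^m` immersion at `f x`.  (In the charts of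
the immersion `ψ` reads `u ↦ e (u, 0)`, so `f` read in the domain chart is `pr₁ ∘ e⁻¹ ∘ (ψ ∘ f)`
read in the codomain chart.)  This is the `ContMDiffWithinAt` form of Mathlib's
`ContMDiffAt.iff_comp_isImmersionAt` — a **lifting** statement (postcomposition with an
immersion), *not* the `Within` form of the tree's descent lemma
`Literature.Topology.FourManifolds.contMDiffAt_of_comp_isImmersionAt` (precomposition with an
open immersion, `GluingUniqueness.lean`); it is how maps *into* the pieces `M`, `N`
(manifolds with boundary) are shown to be smooth below: by composing with `jA`, `jB`.
[folklore] -/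
theorem _root_.ContMDiffWithinAt.iff_comp_isImmersionAt [IsManifold IM m M'] [IsManifold IN m N']
    {f : X → M'} {ψ : M' → N'} {s : Set X} {x : X}
    (hψ : Manifold.IsImmersionAt IM IN m ψ (f x)) :
    ContMDiffWithinAt IX IM m f s x ↔
      ContinuousWithinAt f s x ∧ ContMDiffWithinAt IX IN m (ψ ∘ f) s x := by
  constructor
  · exact fun hf => ⟨hf.continuousWithinAt, hψ.contMDiffAt.comp_contMDiffWithinAt x hf⟩
  rintro ⟨hc, h'⟩
  have h := hψ.isImmersionAtOfComplement_complement
  -- the key identity: in the charts of the immersion, `f = pr₁ ∘ e⁻¹ ∘ (ψ ∘ f)`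
  have key : ∀ y, f y ∈ h.domChart.source → (h.domChart.extend IM ∘ f) y =
      ((Prod.fst ∘ h.equiv.symm) ∘ (h.codChart.extend IN ∘ (ψ ∘ f))) y := by
    intro y hy
    have hmem : h.domChart.extend IM (f y) ∈ (h.domChart.extend IM).target :=
      (h.domChart.extend IM).map_source (by rwa [OpenPartialHomeomorph.extend_source])
    have hw := h.writtenInCharts hmem
    simp only [comp_apply, h.domChart.extend_left_inv hy] at hw
    simp only [comp_apply, hw, ContinuousLinearEquiv.symm_apply_apply]
  rw [contMDiffWithinAt_iff_target_of_mem_maximalAtlas h.domChart_mem_maximalAtlas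
    h.mem_domChart_source]
  refine ⟨hc, ?_⟩
  have h1 : ContMDiffWithinAt IX 𝓘(𝕜, EN) m (h.codChart.extend IN ∘ (ψ ∘ f)) s x :=
    ((contMDiffWithinAt_iff_target_of_mem_maximalAtlas (f := ψ ∘ f) (x := x) (s := s)
      h.codChart_mem_maximalAtlas h.mem_codChart_source).1 h').2
  have h2 : ContMDiffWithinAt IX 𝓘(𝕜, EM) m
      ((Prod.fst ∘ h.equiv.symm) ∘ (h.codChart.extend IN ∘ (ψ ∘ f))) s x := by
    have hl : ContMDiff 𝓘(𝕜, EN) 𝓘(𝕜, EM) m (Prod.fst ∘ (h.equiv.symm : EN → EM × _)) := by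
      rw [contMDiff_iff_contDiff]
      exact contDiff_fst.comp h.equiv.symm.contDiff
    exact (hl _).comp_contMDiffWithinAt x h1
  refine h2.congr_of_eventuallyEq ?_ (key x h.mem_domChart_source)
  have hmem : f ⁻¹' h.domChart.source ∈ 𝓝[s] x :=
    hc (h.domChart.open_source.mem_nhds h.mem_domChart_source)
  filter_upwards [hmem] with y hy
  exact key y hy

/-- One direction of `ContMDiffWithinAt.iff_comp_isImmersionAt` (lifting), in the form used
below.
[folklore] -/
theorem _root_.ContMDiffWithinAt.of_comp_isImmersionAt [IsManifold IM m M'] [IsManifold IN m N']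
    {f : X → M'} {ψ : M' → N'} {s : Set X} {x : X}
    (hψ : Manifold.IsImmersionAt IM IN m ψ (f x)) (hc : ContinuousWithinAt f s x)
    (h : ContMDiffWithinAt IX IN m (ψ ∘ f) s x) : ContMDiffWithinAt IX IM m f s x :=
  (ContMDiffWithinAt.iff_comp_isImmersionAt hψ).2 ⟨hc, h⟩

end Lift

/-! ### The left inverses of the piece embeddings -/

section Inverses

variable {n : ℕ} {M N : Type u} [TopologicalSpace M] [ChartedSpace (ℍ (n + 1)) M]
  [TopologicalSpace N] [ChartedSpace (ℍ (n + 1)) N]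
  {bM : BoundaryData (𝓡∂ (n + 1)) M (𝓡 n)} {bN : BoundaryData (𝓡∂ (n + 1)) N (𝓡 n)}
  {φ : bM.carrier ≃ bN.carrier}
  {P : Type w} [TopologicalSpace P] [ChartedSpace (𝔼 (n + 1)) P]
  (G : BoundaryGluingData bM bN φ P)

namespace BoundaryGluingData

/-- A (total) **left inverse `P → M` of `jA`** (by `Function.invFun`; meaningful on `range jA`).
[folklore] -/
def invA [Nonempty M] : P → M := Function.invFun G.jA

/-- A (total) **left inverse `P → N` of `jB`**. [folklore] -/
def invB [Nonempty N] : P → N := Function.invFun G.jB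

/-- `invA` inverts `jA` on the left. [folklore] -/
@[simp] theorem invA_jA [Nonempty M] (a : M) : G.invA (G.jA a) = a :=
  Function.leftInverse_invFun G.injective_jA a

/-- `invB` inverts `jB` on the left. [folklore] -/
@[simp] theorem invB_jB [Nonempty N] (b : N) : G.invB (G.jB b) = b :=
  Function.leftInverse_invFun G.injective_jB b

/-- `invA` inverts `jA` on the right on `range jA`. [folklore] -/
theorem jA_invA [Nonempty M] {p : P} (hp : p ∈ range G.jA) : G.jA (G.invA p) = p :=
  Function.invFun_eq hp

/-- `invB` inverts `jB` on the right on `range jB`. [folklore] -/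
theorem jB_invB [Nonempty N] {p : P} (hp : p ∈ range G.jB) : G.jB (G.invB p) = p :=
  Function.invFun_eq hp

/-- The left inverses of the swapped data (definitional). [folklore] -/
@[simp] theorem symm_invA [Nonempty N] : G.symm.invA = G.invB := rfl

/-- The left inverses of the swapped data (definitional). [folklore] -/
@[simp] theorem symm_invB [Nonempty M] : G.symm.invB = G.invA := rfl

/-- `invA` is continuous on `range jA` (it is the inverse of the homeomorphism `jA : M ≃ range jA`).
[folklore] -/
theorem continuousOn_invA [Nonempty M] : ContinuousOn G.invA (range G.jA) := by
  rw [continuousOn_iff_continuous_restrict]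
  set e := G.isSmoothEmbedding_jA.isEmbedding.toHomeomorph with he
  have : (range G.jA).restrict G.invA = e.symm := by
    funext p
    obtain ⟨a, ha⟩ := e.surjective p
    rw [← ha, Homeomorph.symm_apply_apply]
    show G.invA (e a).1 = a
    exact G.invA_jA a
  rw [this]
  exact e.symm.continuous

/-- `invB` is continuous on `range jB`. [folklore] -/
theorem continuousOn_invB [Nonempty N] : ContinuousOn G.invB (range G.jB) :=
  G.symm.continuousOn_invA

variable {EX HX : Type*} [NormedAddCommGroup EX] [NormedSpace ℝ EX] [TopologicalSpace HX]
  {IX : ModelWithCorners ℝ EX HX} {X : Type*} [TopologicalSpace X] [ChartedSpace HX X]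

/-- **Maps into the first piece are smooth when they are continuous and smooth after `jA`.**
[folklore] -/
theorem contMDiffWithinAt_of_comp_jA [IsManifold (𝓡∂ (n + 1)) ∞ M] [IsManifold (𝓡 (n + 1)) ∞ P]
    {c : X → M} {s : Set X} {x : X} (hc : ContinuousWithinAt c s x)
    (h : ContMDiffWithinAt IX (𝓡 (n + 1)) ∞ (G.jA ∘ c) s x) :
    ContMDiffWithinAt IX (𝓡∂ (n + 1)) ∞ c s x :=
  ContMDiffWithinAt.of_comp_isImmersionAt (G.isSmoothEmbedding_jA.isImmersion.isImmersionAt _) hc h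

/-- **Maps into the second piece are smooth when they are continuous and smooth after `jB`.**
[folklore] -/
theorem contMDiffWithinAt_of_comp_jB [IsManifold (𝓡∂ (n + 1)) ∞ N] [IsManifold (𝓡 (n + 1)) ∞ P]
    {c : X → N} {s : Set X} {x : X} (hc : ContinuousWithinAt c s x)
    (h : ContMDiffWithinAt IX (𝓡 (n + 1)) ∞ (G.jB ∘ c) s x) :
    ContMDiffWithinAt IX (𝓡∂ (n + 1)) ∞ c s x :=
  ContMDiffWithinAt.of_comp_isImmersionAt (G.isSmoothEmbedding_jB.isImmersion.isImmersionAt _) hc h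

/-- **The left inverse `jA⁻¹` is `C^∞` on `range jA`** (in the within sense, as a map into the
manifold with boundary `M`). [folklore] -/
theorem contMDiffOn_invA [Nonempty M] [IsManifold (𝓡∂ (n + 1)) ∞ M] [IsManifold (𝓡 (n + 1)) ∞ P] :
    ContMDiffOn (𝓡 (n + 1)) (𝓡∂ (n + 1)) ∞ G.invA (range G.jA) := by
  intro p hp
  refine G.contMDiffWithinAt_of_comp_jA (G.continuousOn_invA p hp) ?_
  refine (contMDiffWithinAt_id (I := 𝓡 (n + 1)) (n := ∞)).congr (fun q hq => ?_) ?_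
  · exact G.jA_invA hq
  · exact G.jA_invA hp

/-- **The left inverse `jB⁻¹` is `C^∞` on `range jB`.** [folklore] -/
theorem contMDiffOn_invB [Nonempty N] [IsManifold (𝓡∂ (n + 1)) ∞ N] [IsManifold (𝓡 (n + 1)) ∞ P] :
    ContMDiffOn (𝓡 (n + 1)) (𝓡∂ (n + 1)) ∞ G.invB (range G.jB) :=
  G.symm.contMDiffOn_invA

end BoundaryGluingData

end Inverses

/-! ### The comparison map between two gluings of the same pieces -/

section Compare

variable {n : ℕ} {M N : Type u} [TopologicalSpace M] [ChartedSpace (ℍ (n + 1)) M]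
  [TopologicalSpace N] [ChartedSpace (ℍ (n + 1)) N]
  {bM : BoundaryData (𝓡∂ (n + 1)) M (𝓡 n)} {bN : BoundaryData (𝓡∂ (n + 1)) N (𝓡 n)}
  {φ : bM.carrier ≃ bN.carrier}
  {P : Type w} [TopologicalSpace P] [ChartedSpace (𝔼 (n + 1)) P]
  {P' : Type*} [TopologicalSpace P'] [ChartedSpace (𝔼 (n + 1)) P']
  (G : BoundaryGluingData bM bN φ P) (G' : BoundaryGluingData bM bN φ P')

namespace BoundaryGluingData

/-- A point not in the first piece is in the second. [folklore] -/
theorem exists_jB_eq_of_not {p : P} (h : ¬ ∃ a, G.jA a = p) : ∃ b, G.jB b = p := by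
  have := G.range_union.symm.subset (mem_univ p)
  exact this.resolve_left h

/-- **The comparison map** `h : P → P'` between two gluings of the same pieces along the same
identification: `jA a ↦ jA' a`, `jB b ↦ jB' b` (well defined because both data meet exactly
along `∂M ≡_φ ∂N`).  This is the homeomorphism `h` of Hirsch's smoothing theorem (1976, Ch. 8,
Thm. 1.9): it maps the two pieces diffeomorphically, but is in general not smooth across the
seam. [cite: HirschDT1976, Ch. 8 §1, Thm. 1.9] -/
def compare (p : P) : P' :=
  haveI := Classical.propDecidable
  if h : ∃ a, G.jA a = p then G'.jA h.choose else G'.jB (G.exists_jB_eq_of_not h).choose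

/-- The comparison map on the first piece. [folklore] -/
@[simp] theorem compare_jA (a : M) : G.compare G' (G.jA a) = G'.jA a := by
  have h : ∃ a', G.jA a' = G.jA a := ⟨a, rfl⟩
  rw [compare, dif_pos h, G.injective_jA h.choose_spec]

/-- The comparison map on the second piece. [folklore] -/
@[simp] theorem compare_jB (b : N) : G.compare G' (G.jB b) = G'.jB b := by
  by_cases h : ∃ a, G.jA a = G.jB b
  · rw [compare, dif_pos h]
    obtain ⟨z, hz, rfl⟩ := (G.jA_eq_jB_iff _ _).1 h.choose_spec
    rw [hz, G'.jA_incl]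
  · rw [compare, dif_neg h, G.injective_jB (G.exists_jB_eq_of_not h).choose_spec]

/-- The comparison maps of `(G, G')` and `(G', G)` are mutually inverse. [folklore] -/
@[simp] theorem compare_compare (p : P) : G'.compare G (G.compare G' p) = p := by
  rcases G.range_union.symm.subset (mem_univ p) with ⟨a, rfl⟩ | ⟨b, rfl⟩
  · rw [compare_jA, compare_jA]
  · rw [compare_jB, compare_jB]

/-- The comparison map is a bijection. [folklore] -/
theorem bijective_compare : Bijective (G.compare G') :=
  Function.bijective_iff_has_inverse.2 ⟨G'.compare G, G.compare_compare G', G'.compare_compare G⟩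

/-- The comparison map as an equivalence. [folklore] -/
def compareEquiv : P ≃ P' where
  toFun := G.compare G'
  invFun := G'.compare G
  left_inv := G.compare_compare G'
  right_inv := G'.compare_compare G

/-- Unfolding lemma (definitional). [folklore] -/
@[simp] theorem compareEquiv_apply (p : P) : G.compareEquiv G' p = G.compare G' p := rfl

/-- Unfolding lemma (definitional). [folklore] -/
@[simp] theorem compareEquiv_symm_apply (p' : P') : (G.compareEquiv G').symm p' = G'.compare G p' :=
  rfl

/-- The comparison map of the swapped data is the same map. [folklore] -/
@[simp] theorem symm_compare_symm : G.symm.compare G'.symm = G.compare G' := by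
  funext p
  rcases G.range_union.symm.subset (mem_univ p) with ⟨a, rfl⟩ | ⟨b, rfl⟩
  · rw [compare_jA, show G.jA a = G.symm.jB a from rfl, compare_jB]; rfl
  · rw [compare_jB, show G.jB b = G.symm.jA b from rfl, compare_jA]; rfl

/-- The comparison map sends seam points to the corresponding seam points. [folklore] -/
theorem compare_jA_incl (z : bM.carrier) : G.compare G' (G.jA (bM.incl z)) = G'.jA (bM.incl z) :=
  G.compare_jA G' _

/-- The comparison map sends the seam to the seam. [folklore] -/
theorem compare_mem_seam_iff (p : P) : G.compare G' p ∈ G'.seam ↔ p ∈ G.seam := by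
  rcases G.range_union.symm.subset (mem_univ p) with ⟨a, rfl⟩ | ⟨b, rfl⟩
  · rw [compare_jA, G'.jA_mem_seam_iff, G.jA_mem_seam_iff]
  · rw [compare_jB, ← G'.symm_seam, ← G.symm_seam]
    exact (G'.symm.jA_mem_seam_iff b).trans (G.symm.jA_mem_seam_iff b).symm

/-- The comparison map preserves the first piece. [folklore] -/
theorem compare_mem_range_jA_iff (p : P) : G.compare G' p ∈ range G'.jA ↔ p ∈ range G.jA := by
  rcases G.range_union.symm.subset (mem_univ p) with ⟨a, rfl⟩ | ⟨b, rfl⟩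
  · simp
  · rw [compare_jB]
    constructor
    · rintro ⟨a, ha⟩
      exact ⟨a, by simpa using congrArg (G'.compare G) ha⟩
    · rintro ⟨a, ha⟩
      exact ⟨a, by simpa using congrArg (G.compare G') ha⟩

/-- The comparison map preserves the second piece. [folklore] -/
theorem compare_mem_range_jB_iff (p : P) : G.compare G' p ∈ range G'.jB ↔ p ∈ range G.jB := by
  rcases G.range_union.symm.subset (mem_univ p) with ⟨a, rfl⟩ | ⟨b, rfl⟩
  · rw [compare_jA]
    constructor
    · rintro ⟨b, hb⟩
      exact ⟨b, by simpa using congrArg (G'.compare G) hb⟩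
    · rintro ⟨b, hb⟩
      exact ⟨b, by simpa using congrArg (G.compare G') hb⟩
  · simp

variable [IsManifold (𝓡∂ (n + 1)) ∞ M] [IsManifold (𝓡∂ (n + 1)) ∞ N] [IsManifold (𝓡 (n + 1)) ∞ P]

/-- **The comparison map is continuous** (its composites with the closed embeddings `jA`, `jB`
are `jA'`, `jB'`; closed-cover criterion). [folklore] -/
theorem continuous_compare : Continuous (G.compare G') := by
  rw [continuous_iff_isClosed]
  intro C hC
  refine G.isClosed_of_preimage ?_ ?_
  · have : G.jA ⁻¹' (G.compare G' ⁻¹' C) = G'.jA ⁻¹' C := by ext a; simp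
    rw [this]; exact hC.preimage G'.continuous_jA
  · have : G.jB ⁻¹' (G.compare G' ⁻¹' C) = G'.jB ⁻¹' C := by ext b; simp
    rw [this]; exact hC.preimage G'.continuous_jB

/-- The comparison map as a homeomorphism. [folklore] -/
def compareHomeomorph [IsManifold (𝓡 (n + 1)) ∞ P'] : P ≃ₜ P' where
  toEquiv := G.compareEquiv G'
  continuous_toFun := G.continuous_compare G'
  continuous_invFun := G'.continuous_compare G

omit [IsManifold (𝓡∂ (n + 1)) ∞ N] in
/-- **The comparison map is smooth at the images of interior points of `M`** (descent of
smoothness along the immersion `jA`, which is open at interior points). [folklore] -/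
theorem contMDiffAt_compare_jA [IsManifold (𝓡 (n + 1)) ∞ P'] {a : M}
    (ha : a ∈ (𝓡∂ (n + 1)).interior M) :
    ContMDiffAt (𝓡 (n + 1)) (𝓡 (n + 1)) ∞ (G.compare G') (G.jA a) :=
  contMDiffAt_of_comp_isImmersionAt_of_nhds (G.isSmoothEmbedding_jA.isImmersion.isImmersionAt a)
    (fun _ hU => image_mem_nhds_of_isSmoothEmbedding_of_mem_interior G.isSmoothEmbedding_jA ha hU)
    (G'.contMDiff_jA a) (G.compare_jA G')

omit [IsManifold (𝓡∂ (n + 1)) ∞ M] in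
/-- **The comparison map is smooth at the images of interior points of `N`.** [folklore] -/
theorem contMDiffAt_compare_jB [IsManifold (𝓡 (n + 1)) ∞ P'] {b : N}
    (hb : b ∈ (𝓡∂ (n + 1)).interior N) :
    ContMDiffAt (𝓡 (n + 1)) (𝓡 (n + 1)) ∞ (G.compare G') (G.jB b) :=
  contMDiffAt_of_comp_isImmersionAt_of_nhds (G.isSmoothEmbedding_jB.isImmersion.isImmersionAt b)
    (fun _ hU => image_mem_nhds_of_isSmoothEmbedding_of_mem_interior G.isSmoothEmbedding_jB hb hU)
    (G'.contMDiff_jB b) (G.compare_jB G')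

/-- **The comparison map is smooth off the seam**: it is `C^∞` at every point not on the seam
(and so is its inverse `G'.compare G`, at the corresponding point, by symmetry and
`compare_mem_seam_iff`). [folklore] -/
theorem contMDiffAt_compare [IsManifold (𝓡 (n + 1)) ∞ P'] {p : P} (hp : p ∉ G.seam) :
    ContMDiffAt (𝓡 (n + 1)) (𝓡 (n + 1)) ∞ (G.compare G') p := by
  rcases G.mem_seam_or p with h | ⟨a, ha, rfl⟩ | ⟨b, hb, rfl⟩
  · exact absurd h hp
  · exact G.contMDiffAt_compare_jA G' ha
  · exact G.contMDiffAt_compare_jB G' hb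

/-- The comparison map is smooth on the complement of the seam. [folklore] -/
theorem contMDiffOn_compare [IsManifold (𝓡 (n + 1)) ∞ P'] :
    ContMDiffOn (𝓡 (n + 1)) (𝓡 (n + 1)) ∞ (G.compare G') G.seamᶜ :=
  fun _ hp => (G.contMDiffAt_compare G' hp).contMDiffWithinAt

end BoundaryGluingData

end Compare

end Literature.Topology.FourManifolds
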